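import Literature.Analysis.FluidPDE.WeylLemmaBall
import Literature.Analysis.FluidPDE.NewtonNearGradPotential
import Literature.Analysis.FluidPDE.BiotSavartNewtonKernel
import Literature.Analysis.FluidPDE.OffDiagonalHeatSmoothing
import HarnessLib

/-!
# Very weak Poisson solutions on a ball: interior representation and the weak gradient

Analysis/FluidPDE support file (everything proved; no definitions, no named facts), written for
the proof of the named fact `Literature.Analysis.FluidPDE.jia_sverak_2014_local_higher_regularity`
(H. Jia, V. Šverák, Invent. Math. 196 (2014) = arXiv:1204.0529, §3 Thm 3.2 and the bootstrap
remark after its proof, p. 9: "The estimates for `∂ₜ∂ₓ^α u` … follow from differentiating the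
equation"). In the localised Duhamel formula of a Leray solution the pressure enters the inner
ball only through the gradient of the scalar potential `Q = W₊ ⊛ [φp]`, and incompressibility
makes each time slice of `Q` a **very weak solution of a Poisson equation** `ΔQ = f` on a ball,
`Q ∈ L¹` with a (Hölder) continuous source `f`. This file is the elliptic step of the bootstrap,
in the boundary-free potential-theoretic vocabulary of the tree (`NewtonLocalPotential.lean`:
truncated potential `N[g] = Γ₀ ⋆ g`, `Γ₀ = θΓ`, smoothing `Λ[g] = λ ⋆ g`, `λ = Δ((1-θ)Γ)`, Green's
representation `ΔN[φ] = φ - Λ[φ]`; `WeylLemmaBall.lean`: the case `f = 0`):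

* `integral_mul_newtonNearPotential_comm` — symmetry `∫ f N[φ] = ∫ φ N[f]` (`Γ₀` even; Fubini);
* `ae_eq_newtonFarSmoothing_add_newtonNearPotential` — **if `∫_B Q Δφ = ∫ f φ` for all
  `φ ∈ C_c^∞(B(c, R))`, then `Q = Λ[1_B Q] + N[f]` a.e. on `B(c, R - r₁)`** (test with `N[φ]`,
  a test function on `B(c, R)` when `φ` is one on the smaller ball);
* `integral_newtonNear_mul_fderiv_eq` — integration by parts against the `W^{1,1}` kernel `Γ₀`
  (from the tree's identity for `Γ`, `integral_newtonKernel_smul_fderiv_eq`, and the classical one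
  for the smooth `Γ∞ = Γ - Γ₀`);
* `integral_newtonNearPotential_mul_fderiv_eq` — **the distributional gradient of `N[f]` is the
  near gradient potential**: `∫ N[f] ∂ₐξ = -∫ T⁰ₐf ξ`, `T⁰ₐf = ∫ ∂ₐΓ₀(· - y) f(y) dy`
  (`newtonNearGradPotential`, which the tree shows to be `C^{1,γ}` for `γ`-Hölder `f` with
  Gilbarg–Trudinger's Lemma 4.2/4.4 bounds, `NewtonNearGradPotential.lean`) — Gilbarg–Trudinger's
  Lemma 4.1 in weak form, which is all the bootstrap needs;
* `exists_norm_iteratedFDeriv_newtonFarSmoothing_le` — all-order interior estimates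
  `‖DᵐΛ[G]‖ ≤ 𝓛 m ‖G‖₁` (derivatives on the kernel, `OffDiagonalHeatSmoothing.lean`);
* `integral_mul_fderiv_apply_eq_of_veryWeakPoisson` — **the weak gradient of `Q` on
  `B(c, R - r₁)` is the function `∇Λ[1_BQ] + T⁰f`**: `∫ Q ∂ₐξ = -∫ (∂ₐΛ[1_BQ] + T⁰ₐf) ξ`.

## References

* D. Gilbarg, N. S. Trudinger, *Elliptic Partial Differential Equations of Second Order* (2001),
  Thm. 2.10, (2.16)–(2.17), Lemmas 4.1–4.2. Bib key `GilbargTrudinger2001`.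
* H. Weyl, Duke Math. J. 7 (1940), Lemma 2. [folklore]
* H. Jia, V. Šverák, Invent. Math. 196 (2014) = arXiv:1204.0529, §3 (p. 9). Bib key
  `JiaSverak2014`.
-/

noncomputable section

open MeasureTheory Set Function Filter Metric InnerProductSpace TopologicalSpace
open _root_.Topology
open scoped ENNReal NNReal ContDiff Laplacian Convolution

namespace Literature.Analysis.FluidPDE

namespace PoissonWeyl

local notation "ℝ³" => EuclideanSpace ℝ (Fin 3)

variable {r₀ r₁ : ℝ}

/-! ## Evenness of `Γ₀`, oddness of `∂ₐΓ₀` -/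

/-- `Γ` is even. [folklore] -/
theorem newtonKernel_neg' (z : ℝ³) : newtonKernel (-z) = newtonKernel z := by
  rw [newtonKernel_eq, newtonKernel_eq, norm_neg]

/-- `Γ₀` is even. [folklore] -/
theorem newtonNear_neg' (r₀ r₁ : ℝ) (z : ℝ³) : newtonNear r₀ r₁ (-z) = newtonNear r₀ r₁ z := by
  rw [newtonNear, newtonNear, newtonKernel_neg', radialCutoff_radial r₀ r₁ (norm_neg z)]

/-- `∂ₐΓ₀` is odd. [folklore] -/
theorem newtonNearGrad_neg (r₀ r₁ : ℝ) (a z : ℝ³) :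
    newtonNearGrad r₀ r₁ a (-z) = -newtonNearGrad r₀ r₁ a z := by
  set L : ℝ³ ≃L[ℝ] ℝ³ := ContinuousLinearEquiv.neg ℝ with hL
  have heven : newtonNear r₀ r₁ ∘ (L : ℝ³ → ℝ³) = newtonNear r₀ r₁ := by
    funext w; simp [hL, newtonNear_neg']
  have h := L.comp_right_fderiv (f := newtonNear r₀ r₁) (x := -z)
  rw [heven] at h
  -- `h : fderiv (Γ₀) (-z) = (fderiv Γ₀ (L (-z))).comp L`, and `L (-z) = z`, `L a = -a`
  rw [newtonNearGrad, newtonNearGrad, h]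
  simp [hL]

/-! ## The near potential as a kernel integral and its symmetry -/

/-- `N[g](x) = ∫ Γ₀(x - y) g(y) dy`. [folklore] -/
theorem newtonNearPotential_eq_integral_sub (r₀ r₁ : ℝ) (g : ℝ³ → ℝ) (x : ℝ³) :
    newtonNearPotential r₀ r₁ g x = ∫ y, newtonNear r₀ r₁ (x - y) * g y := by
  rw [newtonNearPotential_apply]
  have h := integral_sub_left_eq_self (fun y => newtonNear r₀ r₁ (x - y) * g y) x (μ := volume)
  simp only [sub_sub_cancel] at h
  rw [← h]

/-- **Symmetry of the near potential**: `∫ f N[φ] = ∫ φ N[f]` for continuous compactly supported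
`f`, `φ` (Fubini; `Γ₀` is even and integrable). [folklore] -/
theorem integral_mul_newtonNearPotential_comm (h₀ : 0 ≤ r₀) (h₁ : r₀ < r₁) {f φ : ℝ³ → ℝ}
    (hf : Continuous f) (hfc : HasCompactSupport f) (hφ : Continuous φ) (hφc : HasCompactSupport φ) :
    ∫ x, f x * newtonNearPotential r₀ r₁ φ x = ∫ y, φ y * newtonNearPotential r₀ r₁ f y := by
  have hΓ : Integrable (newtonNear r₀ r₁) := integrable_newtonNear h₀ h₁
  obtain ⟨Cf, hCf⟩ := hf.bounded_above_of_compact_support hfc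
  obtain ⟨Cφ, hCφ⟩ := hφ.bounded_above_of_compact_support hφc
  have hfi : Integrable f := hf.integrable_of_hasCompactSupport hfc
  have hφi : Integrable φ := hφ.integrable_of_hasCompactSupport hφc
  -- the integrand on the product space
  set Φ : ℝ³ → ℝ³ → ℝ := fun x y => f x * (newtonNear r₀ r₁ (x - y) * φ y) with hΦ
  -- integrability on the product: `|f(x)| |Γ₀(x-y)| |φ(y)| ≤ Cf |Γ₀(x-y)| |φ(y)|`
  have hconv : Integrable (fun p : ℝ³ × ℝ³ => φ p.2 * newtonNear r₀ r₁ (p.1 - p.2)) (volume.prod volume) := by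
    have h := hφi.convolution_integrand (ContinuousLinearMap.mul ℝ ℝ) hΓ (μ := volume) (ν := volume)
    simpa [ContinuousLinearMap.mul_apply'] using h
  have hint : Integrable (uncurry Φ) (volume.prod volume) := by
    have hm : AEStronglyMeasurable (uncurry Φ) (volume.prod volume) := by
      have h1 : AEStronglyMeasurable (fun p : ℝ³ × ℝ³ => f p.1) (volume.prod volume) :=
        (hf.comp continuous_fst).aestronglyMeasurable
      exact h1.mul (hconv.aestronglyMeasurable.congr (Eventually.of_forall fun p => by ring))
    refine (hconv.norm.const_mul Cf).mono' hm (Eventually.of_forall fun p => ?_)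
    simp only [hΦ, uncurry]
    rw [norm_mul, norm_mul, norm_mul]
    calc ‖f p.1‖ * (‖newtonNear r₀ r₁ (p.1 - p.2)‖ * ‖φ p.2‖)
        ≤ Cf * (‖newtonNear r₀ r₁ (p.1 - p.2)‖ * ‖φ p.2‖) :=
          mul_le_mul_of_nonneg_right (hCf _) (by positivity)
      _ = Cf * (‖φ p.2‖ * ‖newtonNear r₀ r₁ (p.1 - p.2)‖) := by ring
  -- left side as an iterated integral
  have hL : ∫ x, f x * newtonNearPotential r₀ r₁ φ x = ∫ x, ∫ y, Φ x y := by
    refine integral_congr_ae (Eventually.of_forall fun x => ?_)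
    simp only [hΦ]
    rw [newtonNearPotential_eq_integral_sub, ← integral_const_mul]
  -- right side as the swapped iterated integral
  have hR : ∫ y, φ y * newtonNearPotential r₀ r₁ f y = ∫ y, ∫ x, Φ x y := by
    refine integral_congr_ae (Eventually.of_forall fun y => ?_)
    simp only [hΦ]
    rw [newtonNearPotential_eq_integral_sub, ← integral_const_mul]
    refine integral_congr_ae (Eventually.of_forall fun x => ?_)
    dsimp only
    rw [show y - x = -(x - y) by abel, newtonNear_neg']
    ring
  rw [hL, hR, integral_integral_swap hint]

/-! ## Weyl's lemma on a ball with a source term -/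

/-- **Interior representation of very weak Poisson solutions.** Let `Q ∈ L¹(B(c, R))` satisfy
`∫_B Q Δφ = ∫ f φ` for all `φ ∈ C_c^∞(B(c, R))`, with a continuous compactly supported source
`f`. Then on `B(c, R - r₁)`,
`Q = Λ[1_B Q] + N[f]` almost everywhere, `Λ = λ^{r₀,r₁} ⋆ ·` the smoothing and
`N = Γ₀^{r₀,r₁} ⋆ ·` the truncated Newtonian potential of the tree (`NewtonLocalPotential.lean`):
for a test function `φ` on the smaller ball, `∫ φ Λ[1_BQ] = ∫_B Q Λ[φ] = ∫_B Q (φ - ΔN[φ])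
= ∫_B Qφ - ∫ f N[φ] = ∫_B Qφ - ∫ N[f] φ` (Green's representation `ΔN[φ] = φ - Λ[φ]`, the weak
Poisson equation tested with `N[φ] ∈ C_c^∞(B(c,R))`, and the symmetry of `N`). The case `f = 0`
is the tree's `WeylLemmaBall.ae_eq_newtonFarSmoothing_indicator` (Weyl 1940, Lemma 2), whose
proof is followed. [cite: GilbargTrudinger2001, Thm. 2.10 and (2.16)–(2.17)] -/
theorem ae_eq_newtonFarSmoothing_add_newtonNearPotential (h₀ : 0 < r₀) (h₁ : r₀ < r₁) {c : ℝ³} {R : ℝ}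
    {Q : ℝ³ → ℝ} (hQ : IntegrableOn Q (ball c R) volume) {f : ℝ³ → ℝ} (hf : Continuous f)
    (hfc : HasCompactSupport f)
    (hpoisson : ∀ φ : ℝ³ → ℝ,
      FunctionSpaces.IsTestFunctionOn (⟨ball c R, isOpen_ball⟩ : Opens ℝ³) φ →
        ∫ x in ball c R, Q x * (Δ φ) x = ∫ x, f x * φ x) :
    Q =ᵐ[volume.restrict (ball c (R - r₁))]
      fun x => newtonFarSmoothing r₀ r₁ ((ball c R).indicator Q) x + newtonNearPotential r₀ r₁ f x := by
  set G : ℝ³ → ℝ := (ball c R).indicator Q with hGdef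
  have hG : Integrable G := hQ.integrable_indicator measurableSet_ball
  set S := newtonFarSmoothing r₀ r₁ G with hS
  have hSc : Continuous S := WeylLemmaBall.continuous_newtonFarSmoothing' h₀ h₁ hG
  set N := newtonNearPotential r₀ r₁ f with hN
  have hNc : Continuous N := (contDiff_newtonNearPotential h₀.le h₁ 0 (contDiff_zero.2 hf)).continuous
  set U : Set ℝ³ := ball c (R - r₁) with hU
  have hLI : LocallyIntegrableOn (fun x => S x + N x - G x) U volume :=
    ((hSc.locallyIntegrable.add hNc.locallyIntegrable).sub hG.locallyIntegrable).locallyIntegrableOn U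
  have hkey : ∀ φ : ℝ³ → ℝ, ContDiff ℝ ∞ φ → HasCompactSupport φ → tsupport φ ⊆ U →
      ∫ x, φ x • (S x + N x - G x) = 0 := by
    intro φ hφ hφc hφU
    have hφT : FunctionSpaces.IsTestFunctionOn (⟨ball c (R - r₁), isOpen_ball⟩ : Opens ℝ³) φ :=
      ⟨hφ, hφc, hφU⟩
    have hφ2 : ContDiff ℝ 2 φ := hφ.of_le (by norm_cast)
    have hφcont : Continuous φ := hφ.continuous
    obtain ⟨Cφ, hCφ⟩ := hφcont.bounded_above_of_compact_support hφc
    -- `N[φ]` is a test function on `B(c, R)`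
    have hNφ : FunctionSpaces.IsTestFunctionOn (⟨ball c R, isOpen_ball⟩ : Opens ℝ³)
        (newtonNearPotential r₀ r₁ φ) :=
      WeylLemmaBall.isTestFunctionOn_newtonNearPotential h₀.le h₁ (by linarith) hφT
    have hΔN : Continuous (Δ (newtonNearPotential r₀ r₁ φ)) :=
      continuous_laplacian (hNφ.contDiff.of_le (by norm_cast))
    have hΔNc : HasCompactSupport (Δ (newtonNearPotential r₀ r₁ φ)) :=
      hNφ.hasCompactSupport.mono' fun x hx => by
        by_contra h
        exact hx (laplacian_eq_zero_of_notMem_tsupport h)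
    obtain ⟨CΔ, hCΔ⟩ := hΔN.bounded_above_of_compact_support hΔNc
    -- the weak Poisson equation tested with `N[φ]`
    have hsrc : ∫ y, G y * (Δ (newtonNearPotential r₀ r₁ φ)) y = ∫ y, f y * newtonNearPotential r₀ r₁ φ y := by
      have h := hpoisson _ hNφ
      rw [← integral_indicator measurableSet_ball] at h
      rw [← h]
      refine integral_congr_ae (Eventually.of_forall fun y => ?_)
      simp only [hGdef]
      exact (indicator_mul_left _ _ _).symm
    -- symmetry of `N`
    have hsymm : ∫ y, f y * newtonNearPotential r₀ r₁ φ y = ∫ y, φ y * N y :=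
      integral_mul_newtonNearPotential_comm h₀.le h₁ hf hfc hφcont hφc
    -- integrability of the pieces
    have hI1 : Integrable fun x => φ x * S x :=
      (hφcont.mul hSc).integrable_of_hasCompactSupport hφc.mul_right
    have hI1' : Integrable fun x => φ x * N x :=
      (hφcont.mul hNc).integrable_of_hasCompactSupport hφc.mul_right
    have hI2 : Integrable fun x => φ x * G x :=
      hG.bdd_mul hφcont.aestronglyMeasurable (Eventually.of_forall hCφ)
    have hI3 : Integrable fun y => G y * φ y :=
      hG.mul_bdd hφcont.aestronglyMeasurable (Eventually.of_forall hCφ)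
    have hI4 : Integrable fun y => G y * (Δ (newtonNearPotential r₀ r₁ φ)) y :=
      hG.mul_bdd hΔN.aestronglyMeasurable (Eventually.of_forall hCΔ)
    -- `∫ φ S = ∫ G φ - ∫ φ N`
    have h1 : ∫ x, φ x * S x = (∫ y, G y * φ y) - ∫ y, φ y * N y := by
      rw [hS, WeylLemmaBall.integral_mul_newtonFarSmoothing h₀ h₁ hG hφcont hφc]
      have hΛ : ∀ y, newtonFarSmoothing r₀ r₁ φ y =
          φ y - (Δ (newtonNearPotential r₀ r₁ φ)) y := fun y => by
        rw [laplacian_newtonNearPotential h₀ h₁ hφ2 y]; ring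
      simp_rw [hΛ, mul_sub]
      rw [integral_sub hI3 hI4, hsrc, hsymm]
    have hsplit : (fun x => φ x • (S x + N x - G x)) = fun x => (φ x * S x + φ x * N x) - φ x * G x := by
      funext x; simp only [smul_eq_mul]; ring
    have hI12 : Integrable (fun x => φ x * S x + φ x * N x) := hI1.add hI1'
    rw [hsplit, integral_sub hI12 hI2, integral_add hI1 hI1', h1]
    have : ∫ y, G y * φ y = ∫ x, φ x * G x := integral_congr_ae (Eventually.of_forall fun x => mul_comm _ _)
    rw [this]; ring
  have hae := isOpen_ball.ae_eq_zero_of_integral_contDiff_smul_eq_zero hLI hkey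
  rw [EventuallyEq, ae_restrict_iff' measurableSet_ball]
  filter_upwards [hae] with x hx hxU
  have hxB : x ∈ ball c R := ball_subset_ball (by linarith) hxU
  have hGx : G x = Q x := by rw [hGdef, indicator_of_mem hxB]
  have := hx hxU
  rw [← hGx]
  linarith

/-! ## The distributional gradient of the near potential is the near gradient potential -/

/-- **Integration by parts against the smooth far kernel**:
`∫ Γ∞(y - x) ∂ₐξ(x) dx = ∫ ∂ₐΓ∞(y - x) ξ(x) dx` for `ξ ∈ C¹_c`. [folklore] -/
theorem integral_newtonFar_mul_fderiv_eq (h₀ : 0 < r₀) (h₁ : r₀ < r₁) {ξ : ℝ³ → ℝ}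
    (hξ : ContDiff ℝ 1 ξ) (hξc : HasCompactSupport ξ) (y a : ℝ³) :
    ∫ x, newtonFar r₀ r₁ (y - x) * fderiv ℝ ξ x a =
      ∫ x, fderiv ℝ (newtonFar r₀ r₁) (y - x) a * ξ x := by
  have hΓ : ContDiff ℝ 1 (newtonFar r₀ r₁) := contDiff_newtonFar h₀ h₁
  -- the product `x ↦ Γ∞(y - x) ξ(x)` is `C¹` with compact support
  set h : ℝ³ → ℝ := fun x => newtonFar r₀ r₁ (y - x) * ξ x with hh
  have hh1 : ContDiff ℝ 1 h := (hΓ.comp (contDiff_const.sub contDiff_id)).mul hξ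
  have hhc : HasCompactSupport h := hξc.mul_left
  have hzero := integral_fderiv_apply_eq_zero hh1 hhc a
  -- expand the derivative of the product
  have hderiv : ∀ x, fderiv ℝ h x a =
      -(fderiv ℝ (newtonFar r₀ r₁) (y - x) a) * ξ x + newtonFar r₀ r₁ (y - x) * fderiv ℝ ξ x a := by
    intro x
    have hd1 : HasFDerivAt (fun x => newtonFar r₀ r₁ (y - x))
        ((fderiv ℝ (newtonFar r₀ r₁) (y - x)).comp (-(ContinuousLinearMap.id ℝ ℝ³))) x := by
      have hin : HasFDerivAt (fun x : ℝ³ => y - x) (-(ContinuousLinearMap.id ℝ ℝ³)) x :=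
        (hasFDerivAt_id x).const_sub y
      exact ((hΓ.differentiable one_ne_zero) (y - x)).hasFDerivAt.comp x hin
    have hd2 : HasFDerivAt ξ (fderiv ℝ ξ x) x := ((hξ.differentiable one_ne_zero) x).hasFDerivAt
    have hprod : HasFDerivAt h
        (newtonFar r₀ r₁ (y - x) • fderiv ℝ ξ x +
          ξ x • (fderiv ℝ (newtonFar r₀ r₁) (y - x)).comp (-(ContinuousLinearMap.id ℝ ℝ³))) x :=
      hd1.mul hd2
    rw [hprod.fderiv]
    simp only [_root_.add_apply, _root_.smul_apply, smul_eq_mul,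
      ContinuousLinearMap.coe_comp, Function.comp_apply, _root_.neg_apply,
      ContinuousLinearMap.coe_id', id_eq, map_neg]
    ring
  -- integrability of the two products
  have hi1 : Integrable fun x => fderiv ℝ (newtonFar r₀ r₁) (y - x) a * ξ x :=
    ((((hΓ.continuous_fderiv one_ne_zero).clm_apply continuous_const).comp
      (continuous_const.sub continuous_id)).mul hξ.continuous).integrable_of_hasCompactSupport hξc.mul_left
  have hi2 : Integrable fun x => newtonFar r₀ r₁ (y - x) * fderiv ℝ ξ x a :=
    ((hΓ.continuous.comp (continuous_const.sub continuous_id)).mul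
      ((hξ.continuous_fderiv one_ne_zero).clm_apply continuous_const)).integrable_of_hasCompactSupport
      (hξc.fderiv_apply (𝕜 := ℝ) a).mul_left
  simp_rw [hderiv] at hzero
  rw [integral_add (by simpa using hi1.neg) hi2] at hzero
  have : ∫ x, -(fderiv ℝ (newtonFar r₀ r₁) (y - x) a) * ξ x = -∫ x, fderiv ℝ (newtonFar r₀ r₁) (y - x) a * ξ x := by
    rw [← integral_neg]; exact integral_congr_ae (Eventually.of_forall fun x => by ring)
  rw [this] at hzero
  linarith

/-- **Integration by parts against the truncated Newtonian kernel**: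
`∫ Γ₀(y - x) ∂ₐξ(x) dx = ∫ ∂ₐΓ₀(y - x) ξ(x) dx` for `ξ ∈ C¹_c` (`Γ₀ = Γ - Γ∞`: the tree's
distributional-gradient identity for `Γ`, `integral_newtonKernel_smul_fderiv_eq`, and the
classical one for the smooth `Γ∞`). [cite: GilbargTrudinger2001, Lemma 4.1] -/
theorem integral_newtonNear_mul_fderiv_eq (h₀ : 0 < r₀) (h₁ : r₀ < r₁) {ξ : ℝ³ → ℝ}
    (hξ : ContDiff ℝ 1 ξ) (hξc : HasCompactSupport ξ) (y a : ℝ³) :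
    ∫ x, newtonNear r₀ r₁ (y - x) * fderiv ℝ ξ x a =
      ∫ x, newtonNearGrad r₀ r₁ a (y - x) * ξ x := by
  have hΓfar : ContDiff ℝ 1 (newtonFar r₀ r₁) := contDiff_newtonFar h₀ h₁
  have hK := integral_newtonKernel_smul_fderiv_eq (F := ℝ) hξ hξc y a
  have hF := integral_newtonFar_mul_fderiv_eq h₀ h₁ hξ hξc y a
  simp only [smul_eq_mul] at hK
  -- integrability of the four pieces
  have hiK1 : Integrable fun x => newtonKernel (y - x) * fderiv ℝ ξ x a := by
    have h := integrable_newtonKernel_smul (F := ℝ) ((hξ.continuous_fderiv one_ne_zero).clm_apply continuous_const)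
      (hξc.fderiv_apply (𝕜 := ℝ) a) y
    simpa [smul_eq_mul] using h
  have hiK2 : Integrable fun x => fderiv ℝ newtonKernel (y - x) a * ξ x := by
    have h := integrable_fderiv_newtonKernel_smul (F := ℝ) hξ.continuous hξc y a
    simpa [smul_eq_mul] using h
  have hiF1 : Integrable fun x => newtonFar r₀ r₁ (y - x) * fderiv ℝ ξ x a :=
    ((hΓfar.continuous.comp (continuous_const.sub continuous_id)).mul
      ((hξ.continuous_fderiv one_ne_zero).clm_apply continuous_const)).integrable_of_hasCompactSupport
      (hξc.fderiv_apply (𝕜 := ℝ) a).mul_left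
  have hiF2 : Integrable fun x => fderiv ℝ (newtonFar r₀ r₁) (y - x) a * ξ x :=
    ((((hΓfar.continuous_fderiv one_ne_zero).clm_apply continuous_const).comp
      (continuous_const.sub continuous_id)).mul hξ.continuous).integrable_of_hasCompactSupport hξc.mul_left
  -- `Γ₀ = Γ - Γ∞` and `∂ₐΓ₀ = ∂ₐΓ - ∂ₐΓ∞` off the origin (a null set after translation)
  have hsplit0 : ∀ x, newtonNear r₀ r₁ (y - x) * fderiv ℝ ξ x a =
      newtonKernel (y - x) * fderiv ℝ ξ x a - newtonFar r₀ r₁ (y - x) * fderiv ℝ ξ x a := fun x => by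
    rw [newtonNear_eq_sub]; ring
  have hsplit1 : ∀ᵐ x ∂(volume : Measure ℝ³), newtonNearGrad r₀ r₁ a (y - x) * ξ x =
      fderiv ℝ newtonKernel (y - x) a * ξ x - fderiv ℝ (newtonFar r₀ r₁) (y - x) a * ξ x := by
    have hne : ∀ᵐ x ∂(volume : Measure ℝ³), x ≠ y := by
      have : ({y} : Set ℝ³)ᶜ ∈ ae (volume : Measure ℝ³) := compl_mem_ae_iff.2 (measure_singleton y)
      filter_upwards [this] with x hx
      simpa using hx
    filter_upwards [hne] with x hx
    have hw : y - x ≠ 0 := sub_ne_zero.2 (Ne.symm hx)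
    have hd : fderiv ℝ (newtonNear r₀ r₁) (y - x) =
        fderiv ℝ newtonKernel (y - x) - fderiv ℝ (newtonFar r₀ r₁) (y - x) := by
      rw [newtonNear_eq_sub]
      exact fderiv_sub (hasFDerivAt_newtonKernel hw).differentiableAt
        ((hΓfar.differentiable one_ne_zero) _)
    rw [newtonNearGrad, hd, _root_.sub_apply]
    ring
  calc ∫ x, newtonNear r₀ r₁ (y - x) * fderiv ℝ ξ x a
      = ∫ x, (newtonKernel (y - x) * fderiv ℝ ξ x a - newtonFar r₀ r₁ (y - x) * fderiv ℝ ξ x a) :=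
        integral_congr_ae (Eventually.of_forall hsplit0)
    _ = (∫ x, newtonKernel (y - x) * fderiv ℝ ξ x a) - ∫ x, newtonFar r₀ r₁ (y - x) * fderiv ℝ ξ x a :=
        integral_sub hiK1 hiF1
    _ = (∫ x, fderiv ℝ newtonKernel (y - x) a * ξ x) - ∫ x, fderiv ℝ (newtonFar r₀ r₁) (y - x) a * ξ x := by
        rw [hK, hF]
    _ = ∫ x, (fderiv ℝ newtonKernel (y - x) a * ξ x - fderiv ℝ (newtonFar r₀ r₁) (y - x) a * ξ x) :=
        (integral_sub hiK2 hiF2).symm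
    _ = ∫ x, newtonNearGrad r₀ r₁ a (y - x) * ξ x := (integral_congr_ae hsplit1).symm

/-- **The distributional gradient of `N[f]` is the near gradient potential `T⁰f`**: for `f`
continuous with compact support, `ξ ∈ C¹_c` and a direction `a`,
`∫ N[f] ∂ₐξ = -∫ T⁰ₐf ξ`, `T⁰ₐf(x) = ∫ ∂ₐΓ₀(x - y) f(y) dy` (`newtonNearGradPotential`). No
differentiability of `N[f]` is claimed (Gilbarg–Trudinger's Lemma 4.1, `D(Γ ⋆ f) = DΓ ⋆ f`, in
weak form: Fubini, the previous integration by parts, `Γ₀` even and `∂ₐΓ₀` odd).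
[cite: GilbargTrudinger2001, Lemma 4.1] -/
theorem integral_newtonNearPotential_mul_fderiv_eq (h₀ : 0 < r₀) (h₁ : r₀ < r₁) {f : ℝ³ → ℝ}
    (hf : Continuous f) (hfc : HasCompactSupport f) {ξ : ℝ³ → ℝ} (hξ : ContDiff ℝ 1 ξ)
    (hξc : HasCompactSupport ξ) (a : ℝ³) :
    ∫ x, newtonNearPotential r₀ r₁ f x * fderiv ℝ ξ x a =
      -∫ x, newtonNearGradPotential r₀ r₁ a f x * ξ x := by
  have hΓ : Integrable (newtonNear r₀ r₁) := integrable_newtonNear h₀.le h₁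
  have hΓ' : Integrable (newtonNearGrad r₀ r₁ a) := integrable_newtonNearGrad h₀ h₁ a
  set η : ℝ³ → ℝ := fun x => fderiv ℝ ξ x a with hη
  have hηc : Continuous η := (hξ.continuous_fderiv one_ne_zero).clm_apply continuous_const
  have hηcs : HasCompactSupport η := hξc.fderiv_apply (𝕜 := ℝ) a
  obtain ⟨Cη, hCη⟩ := hηc.bounded_above_of_compact_support hηcs
  obtain ⟨Cξ, hCξ⟩ := hξ.continuous.bounded_above_of_compact_support hξc
  have hfi : Integrable f := hf.integrable_of_hasCompactSupport hfc
  -- (1) `∫ N[f] η = ∫_y f(y) ∫_x Γ₀(x - y) η(x)`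
  set Φ : ℝ³ → ℝ³ → ℝ := fun x y => η x * (newtonNear r₀ r₁ (x - y) * f y) with hΦ
  have hconv : Integrable (fun p : ℝ³ × ℝ³ => f p.2 * newtonNear r₀ r₁ (p.1 - p.2)) (volume.prod volume) := by
    have h := hfi.convolution_integrand (ContinuousLinearMap.mul ℝ ℝ) hΓ (μ := volume) (ν := volume)
    simpa [ContinuousLinearMap.mul_apply'] using h
  have hint : Integrable (uncurry Φ) (volume.prod volume) := by
    have hm : AEStronglyMeasurable (uncurry Φ) (volume.prod volume) := by
      have h1 : AEStronglyMeasurable (fun p : ℝ³ × ℝ³ => η p.1) (volume.prod volume) :=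
        (hηc.comp continuous_fst).aestronglyMeasurable
      exact h1.mul (hconv.aestronglyMeasurable.congr (Eventually.of_forall fun p => by ring))
    refine (hconv.norm.const_mul Cη).mono' hm (Eventually.of_forall fun p => ?_)
    simp only [hΦ, uncurry]
    rw [norm_mul, norm_mul, norm_mul]
    calc ‖η p.1‖ * (‖newtonNear r₀ r₁ (p.1 - p.2)‖ * ‖f p.2‖)
        ≤ Cη * (‖newtonNear r₀ r₁ (p.1 - p.2)‖ * ‖f p.2‖) :=
          mul_le_mul_of_nonneg_right (hCη _) (by positivity)
      _ = Cη * (‖f p.2‖ * ‖newtonNear r₀ r₁ (p.1 - p.2)‖) := by ring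
  have step1 : ∫ x, newtonNearPotential r₀ r₁ f x * η x = ∫ y, f y * ∫ x, newtonNear r₀ r₁ (y - x) * η x := by
    have hL : ∫ x, newtonNearPotential r₀ r₁ f x * η x = ∫ x, ∫ y, Φ x y := by
      refine integral_congr_ae (Eventually.of_forall fun x => ?_)
      simp only [hΦ]
      rw [newtonNearPotential_eq_integral_sub, mul_comm, ← integral_const_mul]
    rw [hL, integral_integral_swap hint]
    refine integral_congr_ae (Eventually.of_forall fun y => ?_)
    simp only [hΦ]
    rw [← integral_const_mul]
    refine integral_congr_ae (Eventually.of_forall fun x => ?_)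
    dsimp only
    rw [show x - y = -(y - x) by abel, newtonNear_neg']
    ring
  -- (2) integrate by parts in the inner integral and use oddness of `∂ₐΓ₀`
  have step2 : ∀ y, ∫ x, newtonNear r₀ r₁ (y - x) * η x = -∫ x, newtonNearGrad r₀ r₁ a (x - y) * ξ x := by
    intro y
    rw [hη, integral_newtonNear_mul_fderiv_eq h₀ h₁ hξ hξc y a, ← integral_neg]
    refine integral_congr_ae (Eventually.of_forall fun x => ?_)
    beta_reduce
    rw [show y - x = -(x - y) by abel, newtonNearGrad_neg]
    ring
  -- (3) swap back: `∫_y f(y) ∫_x ∂ₐΓ₀(x - y) ξ(x) = ∫_x ξ(x) T⁰ₐf(x)`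
  set Ψ : ℝ³ → ℝ³ → ℝ := fun x y => ξ x * (newtonNearGrad r₀ r₁ a (x - y) * f y) with hΨ
  have hconv' : Integrable (fun p : ℝ³ × ℝ³ => f p.2 * newtonNearGrad r₀ r₁ a (p.1 - p.2)) (volume.prod volume) := by
    have h := hfi.convolution_integrand (ContinuousLinearMap.mul ℝ ℝ) hΓ' (μ := volume) (ν := volume)
    simpa [ContinuousLinearMap.mul_apply'] using h
  have hint' : Integrable (uncurry Ψ) (volume.prod volume) := by
    have hm : AEStronglyMeasurable (uncurry Ψ) (volume.prod volume) := by
      have h1 : AEStronglyMeasurable (fun p : ℝ³ × ℝ³ => ξ p.1) (volume.prod volume) :=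
        (hξ.continuous.comp continuous_fst).aestronglyMeasurable
      exact h1.mul (hconv'.aestronglyMeasurable.congr (Eventually.of_forall fun p => by ring))
    refine (hconv'.norm.const_mul Cξ).mono' hm (Eventually.of_forall fun p => ?_)
    simp only [hΨ, uncurry]
    rw [norm_mul, norm_mul, norm_mul]
    calc ‖ξ p.1‖ * (‖newtonNearGrad r₀ r₁ a (p.1 - p.2)‖ * ‖f p.2‖)
        ≤ Cξ * (‖newtonNearGrad r₀ r₁ a (p.1 - p.2)‖ * ‖f p.2‖) :=
          mul_le_mul_of_nonneg_right (hCξ _) (by positivity)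
      _ = Cξ * (‖f p.2‖ * ‖newtonNearGrad r₀ r₁ a (p.1 - p.2)‖) := by ring
  have step3 : ∫ y, f y * ∫ x, newtonNearGrad r₀ r₁ a (x - y) * ξ x =
      ∫ x, newtonNearGradPotential r₀ r₁ a f x * ξ x := by
    have hL : ∫ y, f y * ∫ x, newtonNearGrad r₀ r₁ a (x - y) * ξ x = ∫ y, ∫ x, Ψ x y := by
      refine integral_congr_ae (Eventually.of_forall fun y => ?_)
      simp only [hΨ]
      rw [← integral_const_mul]
      exact integral_congr_ae (Eventually.of_forall fun x => by ring)
    have hR : ∫ x, newtonNearGradPotential r₀ r₁ a f x * ξ x = ∫ x, ∫ y, Ψ x y := by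
      refine integral_congr_ae (Eventually.of_forall fun x => ?_)
      simp only [hΨ, newtonNearGradPotential, smul_eq_mul]
      rw [mul_comm, ← integral_const_mul]
    rw [hL, hR, ← integral_integral_swap hint']
  rw [step1]
  simp_rw [step2]
  rw [← step3, ← integral_neg]
  refine integral_congr_ae (Eventually.of_forall fun y => ?_)
  beta_reduce
  ring

/-! ## All-order bounds for the smoothing `Λ[G] = λ ⋆ G` -/

/-- `Λ[G]` as a convolution with the kernel on the right: `Λ[G] = G ⋆ λ`. [folklore] -/
theorem newtonFarSmoothing_eq_convolution_right (r₀ r₁ : ℝ) (G : ℝ³ → ℝ) :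
    newtonFarSmoothing r₀ r₁ G = G ⋆[ContinuousLinearMap.lsmul ℝ ℝ, volume] newtonFarLaplacian r₀ r₁ := by
  rw [newtonFarSmoothing_eq_convolution, ← convolution_flip]
  have hL : (ContinuousLinearMap.lsmul ℝ ℝ : ℝ →L[ℝ] ℝ →L[ℝ] ℝ).flip = ContinuousLinearMap.lsmul ℝ ℝ := by
    ext
    simp
  rw [hL]

/-- **All-order interior estimates for the smoothing**: there are constants `𝓛 m` (depending only
on `r₀, r₁, m`) with `‖DᵐΛ[G](x)‖ ≤ 𝓛 m ‖G‖₁` for every `G ∈ L¹` (the derivatives fall on the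
smooth compactly supported kernel `λ`; Gilbarg–Trudinger Thm. 2.10 for the shape of the interior
estimate). [cite: GilbargTrudinger2001, Thm. 2.10] -/
theorem exists_norm_iteratedFDeriv_newtonFarSmoothing_le (h₀ : 0 < r₀) (h₁ : r₀ < r₁) :
    ∃ 𝓛 : ℕ → ℝ, ∀ (G : ℝ³ → ℝ), Integrable G → ∀ (m : ℕ) (x : ℝ³),
      ‖iteratedFDeriv ℝ m (newtonFarSmoothing r₀ r₁ G) x‖ ≤ 𝓛 m * ∫ y, ‖G y‖ := by
  have hk : ContDiff ℝ ∞ (newtonFarLaplacian r₀ r₁) := contDiff_newtonFarLaplacian h₀ h₁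
  have hkc : HasCompactSupport (newtonFarLaplacian r₀ r₁) := hasCompactSupport_newtonFarLaplacian h₀.le h₁
  have hM : ∀ m, ∃ Mm : ℝ, ∀ p, ‖iteratedFDeriv ℝ m (newtonFarLaplacian r₀ r₁) p‖ ≤ Mm := fun m =>
    (hkc.iteratedFDeriv (𝕜 := ℝ) m).exists_bound_of_continuous (hk.continuous_iteratedFDeriv (by exact_mod_cast le_top))
  choose 𝓛 h𝓛 using hM
  refine ⟨𝓛, fun G hG m x => ?_⟩
  rw [newtonFarSmoothing_eq_convolution_right]
  exact OffDiagHeat.norm_iteratedFDeriv_convolution_le m hk hkc (h𝓛 m) hG x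

/-- `Λ[G]` is smooth for `G ∈ L¹`. [folklore] -/
theorem contDiff_newtonFarSmoothing_of_integrable (h₀ : 0 < r₀) (h₁ : r₀ < r₁) {G : ℝ³ → ℝ}
    (hG : Integrable G) : ContDiff ℝ ∞ (newtonFarSmoothing r₀ r₁ G) := by
  rw [newtonFarSmoothing_eq_convolution_right]
  exact OffDiagHeat.contDiff_convolution_lsmul (contDiff_newtonFarLaplacian h₀ h₁)
    (hasCompactSupport_newtonFarLaplacian h₀.le h₁) hG.locallyIntegrable

/-! ## The weak gradient of a very weak Poisson solution on an inner ball -/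

/-- Classical integration by parts for a `C¹` function against a `C¹_c` test:
`∫ S ∂ₐξ = -∫ ∂ₐS ξ`. [folklore] -/
theorem integral_mul_fderiv_apply_eq_neg {S ξ : ℝ³ → ℝ} (hS : ContDiff ℝ 1 S) (hξ : ContDiff ℝ 1 ξ)
    (hξc : HasCompactSupport ξ) (a : ℝ³) :
    ∫ x, S x * fderiv ℝ ξ x a = -∫ x, fderiv ℝ S x a * ξ x := by
  set h : ℝ³ → ℝ := fun x => S x * ξ x with hh
  have hh1 : ContDiff ℝ 1 h := hS.mul hξ
  have hhc : HasCompactSupport h := hξc.mul_left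
  have hzero := integral_fderiv_apply_eq_zero hh1 hhc a
  have hderiv : ∀ x, fderiv ℝ h x a = fderiv ℝ S x a * ξ x + S x * fderiv ℝ ξ x a := by
    intro x
    have hd1 : HasFDerivAt S (fderiv ℝ S x) x := ((hS.differentiable one_ne_zero) x).hasFDerivAt
    have hd2 : HasFDerivAt ξ (fderiv ℝ ξ x) x := ((hξ.differentiable one_ne_zero) x).hasFDerivAt
    have hprod : HasFDerivAt h (S x • fderiv ℝ ξ x + ξ x • fderiv ℝ S x) x := hd1.mul hd2
    rw [hprod.fderiv]
    simp only [_root_.add_apply, _root_.smul_apply, smul_eq_mul]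
    ring
  have hi1 : Integrable fun x => fderiv ℝ S x a * ξ x :=
    (((hS.continuous_fderiv one_ne_zero).clm_apply continuous_const).mul hξ.continuous).integrable_of_hasCompactSupport
      hξc.mul_left
  have hi2 : Integrable fun x => S x * fderiv ℝ ξ x a :=
    (hS.continuous.mul ((hξ.continuous_fderiv one_ne_zero).clm_apply continuous_const)).integrable_of_hasCompactSupport
      (hξc.fderiv_apply (𝕜 := ℝ) a).mul_left
  simp_rw [hderiv] at hzero
  rw [integral_add hi1 hi2] at hzero
  linarith

/-- **The weak gradient of a very weak Poisson solution on an inner ball is a function, with a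
representation.** Under the hypotheses of `ae_eq_newtonFarSmoothing_add_newtonNearPotential`,
for every test function `ξ` supported in `B(c, R - r₁)` and every direction `a`,
`∫ Q ∂ₐξ = -∫ (∂ₐΛ[1_BQ] + T⁰ₐf) ξ`: the distributional gradient of `Q` on the inner ball is the
function `∇Λ[1_BQ] + T⁰f`, the first term smooth with all derivatives controlled by `‖Q‖_{L¹(B)}`
(`exists_norm_iteratedFDeriv_newtonFarSmoothing_le`), the second the near gradient potential of
the source (`C^{1,γ}` for Hölder `f`, `NewtonNearGradPotential.lean`). This is the form in which
interior Schauder regularity of the pressure-type potential enters the higher-regularity bootstrap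
of Jia–Šverák 2014 (Thm 3.2, bootstrap remark p. 9): only the gradient of the potential is needed,
and only as a distribution identified with a regular function.
[cite: GilbargTrudinger2001, Lemmas 4.1–4.2 and Thm. 2.10] -/
theorem integral_mul_fderiv_apply_eq_of_veryWeakPoisson (h₀ : 0 < r₀) (h₁ : r₀ < r₁) {c : ℝ³} {R : ℝ}
    {Q : ℝ³ → ℝ} (hQ : IntegrableOn Q (ball c R) volume) {f : ℝ³ → ℝ} (hf : Continuous f)
    (hfc : HasCompactSupport f)
    (hpoisson : ∀ φ : ℝ³ → ℝ,
      FunctionSpaces.IsTestFunctionOn (⟨ball c R, isOpen_ball⟩ : Opens ℝ³) φ →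
        ∫ x in ball c R, Q x * (Δ φ) x = ∫ x, f x * φ x)
    {ξ : ℝ³ → ℝ} (hξ : FunctionSpaces.IsTestFunctionOn (⟨ball c (R - r₁), isOpen_ball⟩ : Opens ℝ³) ξ)
    (a : ℝ³) :
    ∫ x, Q x * fderiv ℝ ξ x a =
      -∫ x, (fderiv ℝ (newtonFarSmoothing r₀ r₁ ((ball c R).indicator Q)) x a +
        newtonNearGradPotential r₀ r₁ a f x) * ξ x := by
  set G : ℝ³ → ℝ := (ball c R).indicator Q with hGdef
  have hG : Integrable G := hQ.integrable_indicator measurableSet_ball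
  set S := newtonFarSmoothing r₀ r₁ G with hS
  have hS1 : ContDiff ℝ 1 S := WeylLemmaBall.contDiff_one_newtonFarSmoothing h₀ h₁ hG
  set N := newtonNearPotential r₀ r₁ f with hN
  have hNc : Continuous N := (contDiff_newtonNearPotential h₀.le h₁ 0 (contDiff_zero.2 hf)).continuous
  have hξ1 : ContDiff ℝ 1 ξ := hξ.contDiff.of_le (by norm_cast)
  have hξc : HasCompactSupport ξ := hξ.hasCompactSupport
  have hηc : Continuous fun x => fderiv ℝ ξ x a := (hξ1.continuous_fderiv one_ne_zero).clm_apply continuous_const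
  have hηcs : HasCompactSupport fun x => fderiv ℝ ξ x a := hξc.fderiv_apply (𝕜 := ℝ) a
  -- replace `Q` by its representative against `∂ₐξ`
  have hae := ae_eq_newtonFarSmoothing_add_newtonNearPotential h₀ h₁ hQ hf hfc hpoisson
  have hae' : (fun x => Q x * fderiv ℝ ξ x a) =ᵐ[volume] fun x => (S x + N x) * fderiv ℝ ξ x a := by
    rw [EventuallyEq, ae_restrict_iff' measurableSet_ball] at hae
    filter_upwards [hae] with x hx
    by_cases hxU : x ∈ ball c (R - r₁)
    · rw [hx hxU]
    · have hzero : fderiv ℝ ξ x a = 0 := by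
        have hx' : x ∉ tsupport ξ := fun h => hxU (hξ.tsupport_subset h)
        rw [fderiv_of_notMem_tsupport ℝ hx']; rfl
      rw [hzero, mul_zero, mul_zero]
  rw [integral_congr_ae hae']
  have hi1 : Integrable fun x => S x * fderiv ℝ ξ x a :=
    (hS1.continuous.mul hηc).integrable_of_hasCompactSupport hηcs.mul_left
  have hi2 : Integrable fun x => N x * fderiv ℝ ξ x a :=
    (hNc.mul hηc).integrable_of_hasCompactSupport hηcs.mul_left
  simp_rw [add_mul]
  rw [integral_add hi1 hi2, integral_mul_fderiv_apply_eq_neg hS1 hξ1 hξc a,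
    hN, integral_newtonNearPotential_mul_fderiv_eq h₀ h₁ hf hfc hξ1 hξc a]
  have hi3 : Integrable fun x => fderiv ℝ S x a * ξ x :=
    (((hS1.continuous_fderiv one_ne_zero).clm_apply continuous_const).mul hξ.contDiff.continuous).integrable_of_hasCompactSupport
      hξc.mul_left
  have hi4 : Integrable fun x => newtonNearGradPotential r₀ r₁ a f x * ξ x := by
    have hT : Continuous (newtonNearGradPotential r₀ r₁ a f) := by
      have h := continuous_integral_smul_comp_sub (integrable_newtonNearGrad h₀ h₁ a)
        (fun z hz => newtonNearGrad_eq_zero_of_lt h₀.le h₁ a hz) hf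
      have hfun : newtonNearGradPotential r₀ r₁ a f = fun x => ∫ z, newtonNearGrad r₀ r₁ a z • f (x - z) := by
        funext x
        rw [newtonNearGradPotential]
        have e := integral_sub_left_eq_self (fun y => newtonNearGrad r₀ r₁ a (x - y) • f y) x (μ := volume)
        simp only [sub_sub_cancel] at e
        rw [← e]
      rw [hfun]; exact h
    exact (hT.mul hξ.contDiff.continuous).integrable_of_hasCompactSupport hξc.mul_left
  rw [← neg_add, ← integral_add hi3 hi4]

end PoissonWeyl

end Literature.Analysis.FluidPDE
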